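import Summits.BirchSwinnertonDyer.Rank1Residual.X11b.Three.LambdaSupplyPadicUnits
import Mathlib.Topology.Algebra.Module.FiniteDimension
import HarnessLib

/-!
# X11b @ `p = 3`, S24-a (λ-supply), part (D-III): log-coordinates — a continuous character of a
# compact group with values in a finite extension of `ℚ_p` has finite order on the common kernel of
# the `ℤ_p`-valued characters

HONEST FRAMING (cell `b2b-bsdres`, run/shared/lean/b2b/bsd-rank1-residual/, verbatim in every
file): the goal of the cell is to DELETE the COMBINATION-SHAPED residual classes of the
Birch–Swinnerton-Dyer formula for ALL analytic-rank `≤ 1` elliptic curves over `ℚ` — assembled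
STRICTLY from published theorems — so that the rank-`≤ 1` remainder becomes exactly the
CONSTRUCTION-SHAPED classes, which are TYPED, NOT attempted. This is not "finishing BSD". Team N8/O2
(X11b at `3`: `3 ‖ N`, `r_an = 1`, `E[3]` irreducible): research route; nothing booked; NO label
changes; O2 stays OPEN. THEOREMS ONLY (elementary `p`-adic analysis); no definition, no fact, no
`sorry`.

PROVENANCE: sub-target S24 'λ-SUPPLY SPLIT' (OWNERS R7-59), seat `b2b-bsdres-x11b3-p7` (gen. 4);
feasibility census `HOME/b2b-bsdres-x11b3-p7/s24/S24-FEASIBILITY.md` step (D3). Setting as in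
`LambdaSupplyPadicUnits.lean`: `F` a normed field and normed `ℚ_p`-algebra, ultrametric, complete,
here moreover FINITE-DIMENSIONAL over `ℚ_p` (in the application: Weil's `lAdicValueField`).

## What this file proves

* §1 the logarithmic series `L(y) = -∑ (1-y)^{n+1}/(n+1)` (the tree's `IwasawaLog`, generic setting)
  is Lipschitz at `1` (`norm_logSeries_le`) and INJECTIVE near `1`: `‖1 - y‖ ≤ 1/4 ∧ L(y) = 0 ⟹ y = 1`
  (`eq_one_of_logSeries_eq_zero`; `‖L(y) + (1-y)‖ ≤ ‖1-y‖/2`).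
* §2 `pow_eq_one_of_forall_character` (**census (D3)**): let `G` be a compact group whose continuous
  characters `G →ₜ* ℤ_p` are all `ℤ_p`-combinations of `Φ₀, Φ₁`; then for every continuous
  `h : G →* Fˣ` there is `M ≥ 1` with `h(σ)^M = 1` for all `σ ∈ ker Φ₀ ∩ ker Φ₁`. Proof: a power
  `h^M` lands in the ball `‖1 - u‖ ≤ 1/4` (`exists_pow_mem_of_isOpen`); `L ∘ h^M : G → F` is a
  continuous additive map (`logSeries_mul`); its `ℚ_p`-coordinates in a basis of `F` are bounded,
  hence after scaling continuous characters `G →ₜ* ℤ_p`, hence combinations of `Φ₀, Φ₁`, hence zero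
  on the common kernel; so `L(h(σ)^M) = 0` and `h(σ)^M = 1` by injectivity. (For `G = Γ_K`, `K`
  imaginary quadratic, the common kernel is `Gal(K̄/K̃_∞)`: "a `p`-adic character is of finite order
  on `Gal(K̄/K̃_∞)`".)

## References

* [Washington1997] L. C. Washington, *Introduction to Cyclotomic Fields*, §5.1 (`p`-adic logarithm),
  §13.1 (`ℤ_p`-extensions; `Gal(K̃/K) ≃ ℤ_p^{r₂+1}`).
* [Serre1973] J.-P. Serre, *A Course in Arithmetic*, Ch. II §3.
-/

noncomputable section

open Filter Topology

namespace Summit.BirchSwinnertonDyer.Rank1Residual.X11b.Three.LambdaSupply.PadicUnits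

open Literature.NumberTheory.Transcendental Literature.NumberTheory.Transcendental.IwasawaLog

variable {p : ℕ} [Fact p.Prime] {F : Type*} [NormedField F] [instF : NormedAlgebra ℚ_[p] F]
  [IsUltrametricDist F]
include instF

/-! ### §1. The logarithmic series near `1`: Lipschitz bound and injectivity -/

/-- **`‖L(y)‖ ≤ ‖1 - y‖` for `‖1 - y‖ ≤ 1/2`** (every term is `≤ (n+1)‖1-y‖^{n+1} ≤ ‖1-y‖`;
ultrametric bound for `tsum`; generic-`F` form of the tree's `norm_padicLogSeriesAlgCl_le`).
[cite: Washington1997, §5.1] -/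
theorem norm_logSeries_le {y : F} (hy : ‖1 - y‖ ≤ 1 / 2) :
    ‖∑' n : ℕ, -((1 - y) ^ (n + 1)) / (n + 1 : F)‖ ≤ ‖1 - y‖ := by
  refine IsUltrametricDist.norm_tsum_le_of_forall_le_of_nonneg (norm_nonneg _) fun n => ?_
  exact (norm_logTerm_le (p := p) (1 - y) n).trans (succ_mul_pow_succ_le (norm_nonneg _) hy n)

omit [Fact p.Prime] instF [IsUltrametricDist F] in
/-- `(n + 2) r^{n+2} ≤ r/2` for `0 ≤ r ≤ 1/4`. [folklore] -/
theorem succ_succ_mul_pow_le {r : ℝ} (hr0 : 0 ≤ r) (hr : r ≤ 1 / 4) (n : ℕ) :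
    ((n + 2 : ℕ) : ℝ) * r ^ (n + 2) ≤ r / 2 := by
  have h2 : ((n + 2 : ℕ) : ℝ) ≤ (2 : ℝ) ^ (n + 1) := by exact_mod_cast Nat.lt_two_pow_self
  have h3 : ((n + 2 : ℕ) : ℝ) * r ^ (n + 1) ≤ 1 / 2 := by
    calc ((n + 2 : ℕ) : ℝ) * r ^ (n + 1) ≤ (2 : ℝ) ^ (n + 1) * (1 / 4 : ℝ) ^ (n + 1) := by gcongr
      _ = (1 / 2 : ℝ) ^ (n + 1) := by rw [← mul_pow]; norm_num
      _ ≤ (1 / 2 : ℝ) ^ 1 := pow_le_pow_of_le_one (by norm_num) (by norm_num) (by omega)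
      _ = 1 / 2 := pow_one _
  calc ((n + 2 : ℕ) : ℝ) * r ^ (n + 2) = (((n + 2 : ℕ) : ℝ) * r ^ (n + 1)) * r := by ring
    _ ≤ (1 / 2) * r := by gcongr
    _ = r / 2 := by ring

/-- **Injectivity of the logarithmic series near `1`**: if `‖1 - y‖ ≤ 1/4` and `L(y) = 0` then
`y = 1`. Indeed `L(y) + (1 - y) = -∑_{n ≥ 1} (1-y)^{n+1}/(n+1)` has norm `≤ ‖1 - y‖/2`.
[cite: Washington1997, §5.1 (the logarithm is injective on a neighbourhood of 1)] -/
theorem eq_one_of_logSeries_eq_zero [CompleteSpace F] {y : F} (hy : ‖1 - y‖ ≤ 1 / 4)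
    (hL : ∑' n : ℕ, -((1 - y) ^ (n + 1)) / (n + 1 : F) = 0) : y = 1 := by
  set t : F := 1 - y with ht
  have ht1 : ‖t‖ < 1 := hy.trans_lt (by norm_num)
  have hsum : Summable fun n : ℕ => -(t ^ (n + 1)) / (n + 1 : F) := summable_logTerm (p := p) ht1
  have hsplit := hsum.tsum_eq_zero_add
  rw [hL] at hsplit
  simp only [Nat.cast_zero, zero_add, pow_one, div_one, Nat.cast_add, Nat.cast_one] at hsplit
  -- `t = ∑_{n} -(t^{n+2})/(n+2)`, a sum of terms of norm `≤ ‖t‖/2`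
  have hbound : ‖∑' n : ℕ, -(t ^ (n + 1 + 1)) / ((n : F) + 1 + 1)‖ ≤ ‖t‖ / 2 := by
    refine IsUltrametricDist.norm_tsum_le_of_forall_le_of_nonneg (by positivity) fun n => ?_
    have h1 := norm_logTerm_le (p := p) t (n + 1)
    push_cast at h1
    have h2 := succ_succ_mul_pow_le (norm_nonneg t) hy n
    push_cast at h2
    have h3 : ((n : ℝ) + 1 + 1) * ‖t‖ ^ (n + 1 + 1) = ((n : ℝ) + 2) * ‖t‖ ^ (n + 2) := by ring
    linarith
  have heq : t = ∑' n : ℕ, -(t ^ (n + 1 + 1)) / ((n : F) + 1 + 1) := by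
    linear_combination hsplit
  have hkey : ‖t‖ ≤ ‖t‖ / 2 := by
    calc ‖t‖ = ‖∑' n : ℕ, -(t ^ (n + 1 + 1)) / ((n : F) + 1 + 1)‖ := by rw [← heq]
      _ ≤ ‖t‖ / 2 := hbound
  have ht0 : ‖t‖ = 0 := by linarith [norm_nonneg t]
  rw [ht] at ht0
  exact (sub_eq_zero.mp (norm_eq_zero.mp ht0)).symm

/-! ### §2. A `p`-adic character has finite order on the common kernel of the `ℤ_p`-characters -/

section Coordinates

variable [CompleteSpace F] [FiniteDimensional ℚ_[p] F]
variable {G : Type*} [Group G] [TopologicalSpace G] [IsTopologicalGroup G] [CompactSpace G]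

omit [NormedField F] instF [IsUltrametricDist F] [CompleteSpace F] [FiniteDimensional ℚ_[p] F]
  [IsTopologicalGroup G] in
/-- **A bounded continuous additive map into `ℚ_p` rescales to a continuous character into `ℤ_p`.**
For `c : G → ℚ_p` continuous with `c(στ) = c σ + c τ` on a compact group there are `k : ℕ` and a
continuous `Φ : G →ₜ* ℤ_p` with `Φ σ = p^k c σ`. [folklore] -/
theorem exists_character_of_additive (c : G → ℚ_[p]) (hc : Continuous c)
    (hmul : ∀ σ τ, c (σ * τ) = c σ + c τ) :
    ∃ (k : ℕ) (Φ : G →ₜ* Multiplicative ℤ_[p]), ∀ σ, ((Φ σ).toAdd : ℚ_[p]) = (p : ℚ_[p]) ^ k * c σ := by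
  have hp : p.Prime := Fact.out
  -- bounded image, rescaled into the unit ball
  obtain ⟨C, hC⟩ := (isCompact_univ.image hc).isBounded.exists_norm_le
  have hC' : ∀ σ, ‖c σ‖ ≤ C := fun σ => hC _ ⟨σ, Set.mem_univ _, rfl⟩
  obtain ⟨k, hk⟩ := pow_unbounded_of_one_lt C (by exact_mod_cast hp.one_lt : (1 : ℝ) < p)
  have hint : ∀ σ, ‖(p : ℚ_[p]) ^ k * c σ‖ ≤ 1 := fun σ => by
    rw [norm_mul, norm_pow, Padic.norm_p, inv_pow]
    have hpk : (0 : ℝ) < (p : ℝ) ^ k := pow_pos (by exact_mod_cast hp.pos) k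
    rw [inv_mul_le_iff₀ hpk, mul_one]
    exact (hC' σ).trans hk.le
  have h1 : c 1 = 0 := by
    have := hmul 1 1
    rw [mul_one] at this
    linear_combination -this
  -- the character
  let ι : G → ℤ_[p] := fun σ => ⟨(p : ℚ_[p]) ^ k * c σ, hint σ⟩
  have hι : ∀ σ, ((ι σ : ℤ_[p]) : ℚ_[p]) = (p : ℚ_[p]) ^ k * c σ := fun σ => rfl
  have hι_one : ι 1 = 0 := PadicInt.ext (by rw [hι, h1, mul_zero, PadicInt.coe_zero])
  have hι_mul : ∀ σ τ, ι (σ * τ) = ι σ + ι τ := fun σ τ =>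
    PadicInt.ext (by rw [PadicInt.coe_add, hι, hι, hι, hmul, mul_add])
  let Φ : G →* Multiplicative ℤ_[p] :=
    { toFun := fun σ => Multiplicative.ofAdd (ι σ)
      map_one' := by simp only [hι_one]; rfl
      map_mul' := fun σ τ => by simp only [hι_mul, ofAdd_add] }
  have hΦc : Continuous Φ :=
    continuous_ofAdd.comp ((continuous_const.mul hc).subtype_mk _)
  exact ⟨k, ⟨Φ, hΦc⟩, fun σ => rfl⟩

/-- **A `p`-adic character has finite order on the common kernel of the `ℤ_p`-characters (census
(D3)).** Let `G` be a compact group with two continuous characters `Φ₀, Φ₁ : G →ₜ* ℤ_p` of which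
every continuous character `G →ₜ* ℤ_p` is a `ℤ_p`-combination (for `G = Γ_K`, `K` imaginary
quadratic: the tree's `ℤ_p`-rank fact, `LambdaSupply.exists_spanningPair`; the common kernel is
`Gal(K̄/K̃_∞)`). Then every continuous `h : G →* Fˣ`, `F` a finite extension of `ℚ_p` (complete
ultrametric normed `ℚ_p`-algebra of finite dimension), satisfies `h(σ)^M = 1` on `ker Φ₀ ∩ ker Φ₁` for
some `M ≥ 1`: a power `h^M` is valued in the ball `‖1 - u‖ ≤ 1/4`, `L ∘ h^M` is a continuous additive
map `G → F` (`logSeries_mul`), its coordinates in a `ℚ_p`-basis of `F` rescale to characters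
`G →ₜ* ℤ_p` (`exists_character_of_additive`) which vanish on the common kernel, so `L(h(σ)^M) = 0`
and `h(σ)^M = 1` (`eq_one_of_logSeries_eq_zero`). [cite: Washington1997, §5.1 and §13.1] -/
theorem pow_eq_one_of_forall_character (Φ₀ Φ₁ : G →ₜ* Multiplicative ℤ_[p])
    (hspan : ∀ f : G →ₜ* Multiplicative ℤ_[p], ∃ a b : ℤ_[p],
      ∀ σ, (f σ).toAdd = a * (Φ₀ σ).toAdd + b * (Φ₁ σ).toAdd)
    (h : G →* Fˣ) (hh : Continuous h) :
    ∃ M : ℕ, 0 < M ∧ ∀ σ, Φ₀ σ = 1 → Φ₁ σ = 1 → (h σ) ^ M = 1 := by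
  have hp : p.Prime := Fact.out
  -- a power of `h` lands in the ball of radius `1/4`
  obtain ⟨B, hB⟩ := exists_ballUnits (F := F) (by norm_num : (0 : ℝ) ≤ 1 / 4)
    (by norm_num : (1 / 4 : ℝ) < 1)
  have hBopen : IsOpen (B : Set Fˣ) := by
    have : (B : Set Fˣ) = {u : Fˣ | ‖1 - (u : F)‖ ≤ 1 / 4} := Set.ext fun u => hB u
    rw [this]
    exact isOpen_setOf_norm_one_sub_le (by norm_num)
  obtain ⟨M, hM, hmem⟩ := exists_pow_mem_of_isOpen h hh B hBopen
  refine ⟨M, hM, fun σ₀ hσ₀ hσ₁ => ?_⟩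
  -- `h' = h^M`, ball-valued
  set h' : G →* Fˣ := (powMonoidHom M).comp h with hh'def
  have hh'c : Continuous h' := (continuous_pow M).comp hh
  have hh'v : ∀ σ, h' σ = (h σ) ^ M := fun σ => rfl
  have hball : ∀ σ, ‖1 - ((h' σ : Fˣ) : F)‖ ≤ 1 / 4 := fun σ => (hB _).mp (hmem σ)
  have hball' : ∀ σ, ‖1 - ((h' σ : Fˣ) : F)‖ < 1 := fun σ => (hball σ).trans_lt (by norm_num)
  -- the logarithm `ℓ = L ∘ h'`, additive and continuous
  let ℓ : G → F := fun σ => ∑' n : ℕ, -((1 - ((h' σ : Fˣ) : F)) ^ (n + 1)) / (n + 1 : F)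
  have hℓ_mul : ∀ σ τ, ℓ (σ * τ) = ℓ σ + ℓ τ := fun σ τ => by
    simp only [ℓ, map_mul, Units.val_mul]
    exact logSeries_mul (p := p) (hball' σ) (hball' τ)
  have hℓ_one : ℓ 1 = 0 := by simp [ℓ]
  have hℓ_norm : ∀ σ, ‖ℓ σ‖ ≤ ‖1 - ((h' σ : Fˣ) : F)‖ := fun σ =>
    norm_logSeries_le (p := p) ((hball σ).trans (by norm_num))
  have hℓ_cont : Continuous ℓ := by
    -- as a homomorphism into `Multiplicative F` it suffices to check continuity at `1`
    let ℓm : G →* Multiplicative F :=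
      { toFun := fun σ => Multiplicative.ofAdd (ℓ σ)
        map_one' := by rw [hℓ_one]; rfl
        map_mul' := fun σ τ => by rw [hℓ_mul]; rfl }
    have hℓm : Continuous ℓm := by
      refine continuous_of_continuousAt_one ℓm ?_
      rw [ContinuousAt, map_one]
      have h0 : (1 : Multiplicative F) = Multiplicative.ofAdd (0 : F) := rfl
      rw [h0]
      refine (continuous_ofAdd.tendsto (0 : F)).comp ?_
      refine Metric.tendsto_nhds.mpr fun ε hε => ?_
      have hU : {σ : G | ‖1 - ((h' σ : Fˣ) : F)‖ < ε} ∈ 𝓝 (1 : G) := by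
        refine IsOpen.mem_nhds ?_ ?_
        · exact isOpen_lt (continuous_const.sub (Units.continuous_val.comp hh'c)).norm continuous_const
        · simp [hε]
      filter_upwards [hU] with σ hσ
      rw [dist_zero_right]
      exact (hℓ_norm σ).trans_lt hσ
    exact continuous_toAdd.comp hℓm
  -- coordinates in a `ℚ_p`-basis of `F`
  let bF : Module.Basis (Fin (Module.finrank ℚ_[p] F)) ℚ_[p] F := Module.finBasis ℚ_[p] F
  have hcoord : ∀ i, ∃ (k : ℕ) (Φ : G →ₜ* Multiplicative ℤ_[p]),
      ∀ σ, ((Φ σ).toAdd : ℚ_[p]) = (p : ℚ_[p]) ^ k * bF.coord i (ℓ σ) := fun i => by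
    have hci : Continuous (bF.coord i : F → ℚ_[p]) :=
      LinearMap.continuous_of_finiteDimensional (𝕜 := ℚ_[p]) (E := F) (F' := ℚ_[p]) (bF.coord i)
    exact exists_character_of_additive (fun σ => bF.coord i (ℓ σ)) (hci.comp hℓ_cont)
      (fun σ τ => by rw [hℓ_mul, map_add])
  choose k Φ hΦ using hcoord
  -- every coordinate of `ℓ σ₀` vanishes
  have hzero : ∀ i, bF.coord i (ℓ σ₀) = 0 := fun i => by
    obtain ⟨a, b, hab⟩ := hspan (Φ i)
    have h0 : (Φ i σ₀).toAdd = 0 := by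
      rw [hab σ₀, hσ₀, hσ₁, toAdd_one, mul_zero, mul_zero, add_zero]
    have h1 := hΦ i σ₀
    rw [h0, PadicInt.coe_zero] at h1
    have hpk : (p : ℚ_[p]) ^ (k i) ≠ 0 := pow_ne_zero _ (by exact_mod_cast hp.ne_zero)
    exact (mul_eq_zero.mp h1.symm).resolve_left hpk
  have hℓ0 : ℓ σ₀ = 0 := bF.ext_elem fun i => by
    change bF.coord i (ℓ σ₀) = bF.coord i 0
    rw [hzero i, map_zero]
  -- injectivity of the logarithm
  have hone : ((h' σ₀ : Fˣ) : F) = 1 := eq_one_of_logSeries_eq_zero (p := p) (hball σ₀) hℓ0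
  rw [← hh'v]
  exact Units.ext hone

end Coordinates

end Summit.BirchSwinnertonDyer.Rank1Residual.X11b.Three.LambdaSupply.PadicUnits

end
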